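import Literature.Analysis.SegalBargmann.HermiteFourier
import HarnessLib

/-!
# Transposes of the oscillator operators on `𝓢(ℝ^σ, ℂ)` and the Hermite coefficients of a Schwartz function
(Folland 1989, §1.7)

Topic `Analysis/SegalBargmann`; namespace `Literature.Analysis.SegalBargmann`.  Continuation of
`Literature.Analysis.SegalBargmann.HermiteFourier`.  For the BILINEAR pairing `bpair f g := ∫ f·g` of Schwartz
functions on `ℝ^σ` (Lebesgue measure on `EuclideanSpace ℝ σ`):

* §1 `bpair` and its bilinearity / symmetry;
* §2 TRANSPOSES (integration by parts, Mathlib `SchwartzMap.integral_mul_lineDerivOp_right_eq_neg_left`):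
  `⟨f, D_j g⟩ = −⟨D_j f, g⟩`, `⟨f, x_j g⟩ = ⟨x_j f, g⟩`, hence `⟨f, Z_j g⟩ = ⟨Z_j^* f, g⟩` and `⟨f, Z_j^* g⟩ = ⟨Z_j f, g⟩`
  — the creation operator is the transpose of the annihilation operator (Folland §1.7: "`Z_j^*` is the formal
  adjoint of `Z_j`"; on the real Hermite functions transpose = adjoint) — and the Hermite operators
  `2π(D_j² + X_j²)` and the number operator `N` are SYMMETRIC.
* §3 the HERMITE COEFFICIENTS `hermiteCoeff α f := ⟨h_α, f⟩` of `f ∈ 𝓢(ℝ^σ, ℂ)` and two spectral identities: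
  `hermiteCoeff α (N f) = |α| · hermiteCoeff α f`, whence `hermiteCoeff α (N^k f) = |α|^k · hermiteCoeff α f` (the
  coefficients of a Schwartz function decay faster than any power of `|α|`, each `N^k f` being again Schwartz), and
  `hermiteCoeff α (𝓕 f) = (−i)^{|α|} · hermiteCoeff α f` (Mathlib's `SchwartzMap.integral_fourier_mul_eq` with
  `HermiteFourier.fourier_hermiteSchwartz_herm`).

Everything is proved from Mathlib and the imported tree files; no cited fact is used as a hypothesis.  The uniform
bound `|hermiteCoeff α g| ≤ ‖g‖_{L²}` (orthonormality, tree `FockHermiteL2`) and the reconstruction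
`f = Σ_α hermiteCoeff α f · h_α` in the Schwartz topology (the `N`-representation theorem for `𝒮(ℝⁿ)`,
Reed–Simon I Thm V.13) are NOT in this file.

## References

* G. B. Folland, *Harmonic Analysis in Phase Space*, Annals of Mathematics Studies 122, Princeton UP (1989), §1.7.
  [cite: Folland1989, §1.7]

## Provenance

Written for the tree under the LEAN-IN-TREE rule (2026-08-18) by the pub-hodgecm formalisation cell (model-construction
sub-cell, seat mc-binder-2).
-/

set_option autoImplicit false

noncomputable section

open MvPolynomial Complex SchwartzMap MeasureTheory FourierTransform
open scoped BigOperators Real LineDeriv FourierTransform RealInnerProductSpace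

namespace Literature.Analysis.SegalBargmann

variable {σ : Type*} [Fintype σ] [DecidableEq σ]

/-! ## §1  The bilinear pairing `∫ f·g` on `𝓢(ℝ^σ, ℂ)` -/

section Pairing

omit [DecidableEq σ] in
/-- The product of two Schwartz functions is integrable (it is again a Schwartz function: Mathlib
`SchwartzMap.bilinLeftCLM`). [folklore] -/
theorem integrable_mul_schwartz (f g : 𝓢(EuclideanSpace ℝ σ, ℂ)) :
    Integrable (fun x : EuclideanSpace ℝ σ => f x * g x) :=
  (SchwartzMap.bilinLeftCLM (ContinuousLinearMap.mul ℝ ℂ) g.hasTemperateGrowth f).integrable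

omit [DecidableEq σ] in
/-- **The bilinear `L²` pairing** `⟨f, g⟩ := ∫ f(x) g(x) dx` of Schwartz functions on `ℝ^σ` (no conjugation).
[folklore] -/
def bpair (f g : 𝓢(EuclideanSpace ℝ σ, ℂ)) : ℂ := ∫ x : EuclideanSpace ℝ σ, f x * g x

omit [DecidableEq σ] in
/-- Unfolding of `bpair`. [folklore] -/
theorem bpair_apply (f g : 𝓢(EuclideanSpace ℝ σ, ℂ)) :
    bpair f g = ∫ x : EuclideanSpace ℝ σ, f x * g x := rfl

omit [DecidableEq σ] in
/-- Symmetry of the pairing. [folklore] -/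
theorem bpair_comm (f g : 𝓢(EuclideanSpace ℝ σ, ℂ)) : bpair f g = bpair g f :=
  integral_congr_ae (Filter.Eventually.of_forall fun _ => mul_comm _ _)

omit [DecidableEq σ] in
/-- The pairing as a linear functional in its second argument. [folklore] -/
def bpairₗ (f : 𝓢(EuclideanSpace ℝ σ, ℂ)) : 𝓢(EuclideanSpace ℝ σ, ℂ) →ₗ[ℂ] ℂ where
  toFun g := bpair f g
  map_add' g₁ g₂ := by
    simp only [bpair, add_apply, mul_add]
    exact integral_add (integrable_mul_schwartz _ _) (integrable_mul_schwartz _ _)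
  map_smul' c g := by
    simp only [bpair, smul_apply, smul_eq_mul, RingHom.id_apply]
    rw [← integral_const_mul]
    refine integral_congr_ae (Filter.Eventually.of_forall fun x => ?_)
    simp only
    ring

omit [DecidableEq σ] in
/-- `bpairₗ f g = bpair f g`. [folklore] -/
@[simp] theorem bpairₗ_apply (f g : 𝓢(EuclideanSpace ℝ σ, ℂ)) : bpairₗ f g = bpair f g := rfl

omit [DecidableEq σ] in
/-- Additivity in the second argument. [folklore] -/
theorem bpair_add_right (f g₁ g₂ : 𝓢(EuclideanSpace ℝ σ, ℂ)) : bpair f (g₁ + g₂) = bpair f g₁ + bpair f g₂ :=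
  map_add (bpairₗ f) g₁ g₂

omit [DecidableEq σ] in
/-- Homogeneity in the second argument. [folklore] -/
theorem bpair_smul_right (f g : 𝓢(EuclideanSpace ℝ σ, ℂ)) (c : ℂ) : bpair f (c • g) = c * bpair f g :=
  map_smul (bpairₗ f) c g

omit [DecidableEq σ] in
/-- Subtraction in the second argument. [folklore] -/
theorem bpair_sub_right (f g₁ g₂ : 𝓢(EuclideanSpace ℝ σ, ℂ)) : bpair f (g₁ - g₂) = bpair f g₁ - bpair f g₂ :=
  map_sub (bpairₗ f) g₁ g₂

omit [DecidableEq σ] in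
/-- Negation in the second argument. [folklore] -/
theorem bpair_neg_right (f g : 𝓢(EuclideanSpace ℝ σ, ℂ)) : bpair f (-g) = -bpair f g := map_neg (bpairₗ f) g

omit [DecidableEq σ] in
/-- Finite sums in the second argument. [folklore] -/
theorem bpair_sum_right {ι : Type*} (f : 𝓢(EuclideanSpace ℝ σ, ℂ)) (s : Finset ι)
    (g : ι → 𝓢(EuclideanSpace ℝ σ, ℂ)) : bpair f (∑ i ∈ s, g i) = ∑ i ∈ s, bpair f (g i) :=
  map_sum (bpairₗ f) g s

omit [DecidableEq σ] in
/-- Additivity in the first argument. [folklore] -/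
theorem bpair_add_left (f₁ f₂ g : 𝓢(EuclideanSpace ℝ σ, ℂ)) : bpair (f₁ + f₂) g = bpair f₁ g + bpair f₂ g := by
  rw [bpair_comm, bpair_add_right, bpair_comm g, bpair_comm g]

omit [DecidableEq σ] in
/-- Homogeneity in the first argument. [folklore] -/
theorem bpair_smul_left (f g : 𝓢(EuclideanSpace ℝ σ, ℂ)) (c : ℂ) : bpair (c • f) g = c * bpair f g := by
  rw [bpair_comm, bpair_smul_right, bpair_comm]

omit [DecidableEq σ] in
/-- Subtraction in the first argument. [folklore] -/
theorem bpair_sub_left (f₁ f₂ g : 𝓢(EuclideanSpace ℝ σ, ℂ)) : bpair (f₁ - f₂) g = bpair f₁ g - bpair f₂ g := by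
  rw [bpair_comm, bpair_sub_right, bpair_comm g, bpair_comm g]

omit [DecidableEq σ] in
/-- Finite sums in the first argument. [folklore] -/
theorem bpair_sum_left {ι : Type*} (s : Finset ι) (f : ι → 𝓢(EuclideanSpace ℝ σ, ℂ))
    (g : 𝓢(EuclideanSpace ℝ σ, ℂ)) : bpair (∑ i ∈ s, f i) g = ∑ i ∈ s, bpair (f i) g := by
  rw [bpair_comm, bpair_sum_right]
  exact Finset.sum_congr rfl fun i _ => bpair_comm _ _

end Pairing

/-! ## §2  Transposes -/

section Transpose

variable (j : σ) (f g : 𝓢(EuclideanSpace ℝ σ, ℂ))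

/-- **`⟨f, ∂_j g⟩ = −⟨∂_j f, g⟩`** along the coordinate vector `e_j` (Mathlib's integration by parts for Schwartz
functions). [folklore] -/
theorem bpair_lineDerivOp_single :
    bpair f (∂_{EuclideanSpace.single j (1 : ℝ)} g) = -bpair (∂_{EuclideanSpace.single j (1 : ℝ)} f) g :=
  SchwartzMap.integral_mul_lineDerivOp_right_eq_neg_left (μ := volume) f g (EuclideanSpace.single j (1 : ℝ))

/-- **`⟨f, D_j g⟩ = −⟨D_j f, g⟩`** (`D_j = (2πi)⁻¹∂_j`). [folklore] -/
theorem bpair_opDCLM : bpair f (opDCLM j g) = -bpair (opDCLM j f) g := by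
  rw [opDCLM_eq_smul, opDCLM_eq_smul, bpair_smul_right, bpair_smul_left, bpair_lineDerivOp_single, mul_neg]

omit [DecidableEq σ] in
/-- **`⟨f, x_j g⟩ = ⟨x_j f, g⟩`** (multiplication operators are symmetric). [folklore] -/
theorem bpair_coordMulCLM : bpair f (coordMulCLM j g) = bpair (coordMulCLM j f) g := by
  refine integral_congr_ae (Filter.Eventually.of_forall fun x => ?_)
  simp only [coordMulCLM_apply]
  ring

/-- **`Z_j^*` is the transpose of `Z_j`**: `⟨f, Z_j g⟩ = ⟨Z_j^* f, g⟩` on `𝓢(ℝ^σ, ℂ)` (Folland §1.7: `Z_j^*` is the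
formal adjoint of `Z_j`). [cite: Folland1989, §1.7] -/
theorem bpair_zCLM : bpair f (zCLM j g) = bpair (zsCLM j f) g := by
  have hz : zCLM j g = coordMulCLM j g + I • opDCLM j g := rfl
  have hzs : zsCLM j f = coordMulCLM j f - I • opDCLM j f := rfl
  rw [hz, hzs, bpair_add_right, bpair_smul_right, bpair_sub_left, bpair_smul_left, bpair_coordMulCLM, bpair_opDCLM,
    mul_neg, sub_eq_add_neg]

/-- **`Z_j` is the transpose of `Z_j^*`**: `⟨f, Z_j^* g⟩ = ⟨Z_j f, g⟩`. [cite: Folland1989, §1.7] -/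
theorem bpair_zsCLM : bpair f (zsCLM j g) = bpair (zCLM j f) g := by
  rw [bpair_comm, ← bpair_zCLM, bpair_comm]

/-- **The Hermite operator is symmetric**: `⟨f, 2π(D_j²+X_j²) g⟩ = ⟨2π(D_j²+X_j²) f, g⟩`. [cite: Folland1989, §1.7] -/
theorem bpair_hermiteOpCLM : bpair f (hermiteOpCLM j g) = bpair (hermiteOpCLM j f) g := by
  have hH : ∀ u : 𝓢(EuclideanSpace ℝ σ, ℂ), hermiteOpCLM j u =
      (2 * π : ℂ) • (opDCLM j (opDCLM j u) + coordMulCLM j (coordMulCLM j u)) := fun u => rfl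
  rw [hH f, hH g, bpair_smul_right, bpair_smul_left, bpair_add_right, bpair_add_left, bpair_opDCLM, bpair_opDCLM,
    neg_neg, bpair_coordMulCLM, bpair_coordMulCLM]

/-- **The number operator is symmetric**: `⟨f, N g⟩ = ⟨N f, g⟩`. [cite: Folland1989, §1.7] -/
theorem bpair_numberOpCLM : bpair f (numberOpCLM g) = bpair (numberOpCLM f) g := by
  have hN : ∀ u : 𝓢(EuclideanSpace ℝ σ, ℂ), numberOpCLM u =
      (1 / 2 : ℂ) • ∑ k : σ, (hermiteOpCLM k u - u) := fun u => by
    rw [numberOpCLM, smul_apply, sum_apply]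
    rfl
  rw [hN f, hN g, bpair_smul_right, bpair_smul_left, bpair_sum_right, bpair_sum_left]
  congr 1
  exact Finset.sum_congr rfl fun k _ => by rw [bpair_sub_right, bpair_sub_left, bpair_hermiteOpCLM]

end Transpose

/-! ## §3  Hermite coefficients of a Schwartz function -/

section Coefficients

/-- **The Hermite coefficient** `c_α(f) := ⟨h_α, f⟩ = ∫ h_α(x) f(x) dx` of a Schwartz function (`h_α` the REAL Hermite
function `hermiteSchwartz (herm α)`, so this is the `L²` inner product `⟨h_α, f⟩`). [cite: Folland1989, §1.7] -/
def hermiteCoeff (α : σ →₀ ℕ) (f : 𝓢(EuclideanSpace ℝ σ, ℂ)) : ℂ := bpair (hermiteSchwartz (herm α)) f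

/-- Unfolding of `hermiteCoeff`. [folklore] -/
theorem hermiteCoeff_apply (α : σ →₀ ℕ) (f : 𝓢(EuclideanSpace ℝ σ, ℂ)) :
    hermiteCoeff α f = ∫ x : EuclideanSpace ℝ σ, hermiteSchwartz (herm α) x * f x := rfl

/-- `hermiteCoeff α` is additive. [folklore] -/
theorem hermiteCoeff_add (α : σ →₀ ℕ) (f g : 𝓢(EuclideanSpace ℝ σ, ℂ)) :
    hermiteCoeff α (f + g) = hermiteCoeff α f + hermiteCoeff α g := bpair_add_right _ _ _

/-- `hermiteCoeff α` is homogeneous. [folklore] -/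
theorem hermiteCoeff_smul (α : σ →₀ ℕ) (c : ℂ) (f : 𝓢(EuclideanSpace ℝ σ, ℂ)) :
    hermiteCoeff α (c • f) = c * hermiteCoeff α f := bpair_smul_right _ _ _

/-- **`c_α(N f) = |α| · c_α(f)`**: the number operator acts on Hermite coefficients by the degree (symmetry of `N`
and `N h_α = |α| h_α`). [cite: Folland1989, Thm 1.83] -/
theorem hermiteCoeff_numberOpCLM (α : σ →₀ ℕ) (f : 𝓢(EuclideanSpace ℝ σ, ℂ)) :
    hermiteCoeff α (numberOpCLM f) = (α.degree : ℂ) * hermiteCoeff α f := by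
  rw [hermiteCoeff, bpair_numberOpCLM, numberOpCLM_herm, bpair_smul_left, hermiteCoeff]

/-- **`c_α(N^k f) = |α|^k · c_α(f)`** — since every `N^k f` is again a Schwartz function, the Hermite coefficients
of `f` decay faster than any power of `|α|`. [cite: Folland1989, §1.7] -/
theorem hermiteCoeff_numberOpCLM_pow (α : σ →₀ ℕ) (k : ℕ) (f : 𝓢(EuclideanSpace ℝ σ, ℂ)) :
    hermiteCoeff α ((numberOpCLM ^ k) f) = (α.degree : ℂ) ^ k * hermiteCoeff α f := by
  induction k with
  | zero =>
      rw [pow_zero, pow_zero, one_mul]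
      rfl
  | succ k ih =>
      rw [pow_succ']
      change hermiteCoeff α (numberOpCLM ((numberOpCLM ^ k) f)) = _
      rw [hermiteCoeff_numberOpCLM, ih, pow_succ]
      ring

/-- **`c_α(𝓕 f) = (−i)^{|α|} · c_α(f)`**: the Fourier transform acts on Hermite coefficients by `(−i)^{|α|}`
(self-adjointness of `𝓕` for the bilinear pairing, Mathlib `SchwartzMap.integral_fourier_mul_eq`, and
`𝓕 h_α = (−i)^{|α|} h_α`). [cite: Folland1989, §1.7] -/
theorem hermiteCoeff_fourier (α : σ →₀ ℕ) (f : 𝓢(EuclideanSpace ℝ σ, ℂ)) :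
    hermiteCoeff α (𝓕 f) = (-I) ^ α.degree * hermiteCoeff α f := by
  rw [hermiteCoeff, bpair_apply, ← SchwartzMap.integral_fourier_mul_eq, fourier_hermiteSchwartz_herm, ← bpair_apply,
    bpair_smul_left, hermiteCoeff]

end Coefficients

end Literature.Analysis.SegalBargmann

end
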